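import Mathlib
import HarnessLib
import HarnessLib.Audit
import Summits.SmoothPoincare4.Statement
import Summits.SmoothPoincare4.SmoothPoincare4.Theses.RootDecompAE
import Literature.Topology.FourManifolds.SmoothTriangulation
import Literature.Topology.FourManifolds.BalancedPresentation
import Literature.Topology.FourManifolds.BalancedPresentationMoves
import Literature.Topology.FourManifolds.PresentationHandlebodyFive
import Literature.Topology.FourManifolds.ClosedBall
import Literature.Topology.FourManifolds.CorkDecomposition

/-!
(SELF-CONTAINED VARIANT `_sc`: identical to the canonical v2 line file except that the tree module
`TriangularPresentationAndrewsCurtis` is vendored in §6.0 instead of imported — see there.)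

# LINE «grade-one-ac» for the crux `RootDecompAE.DoublesShadowLEOne` (item stmt-SmoothPoincare4-32181)

Planner decomp-sp4-lens-1, generation 11 (lens «grading / quantitative ladder»), species R (recognition).

The crux says: a double `X = D(C)` (`C` compact contractible) which is a homotopy 4-sphere and admits a typed
shadow of connected complexity `c* ≤ 1` is diffeomorphic to `S⁴`.  This file isolates its OPEN content as a
purely COMBINATORIAL Andrews–Curtis statement over the tree objects `BalancedPresentation`,
`PresentsTrivialGroup`, `IsStablyAndrewsCurtisEquivalent`, `IsPresentationHandlebodyFive`:

* §1  the typed object `HasConnectedShadowComplexityLE n M` (byte-identical to the gen-9/gen-10 kernels; the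
      route item text is its `n = 1` instance with `IsSmoothTriangulation` unfolded — `hasCSC_inlined_iff` is `Iff.rfl`);
* §2  the Koda–Martelli–Naoe PIECES of a simple polyhedron of connected complexity ≤ 1 (arXiv:1803.06713 Prop. 4.1:
      `D, P, Y₂, Y₁₁₁, Y₁₂, Y₃, X₁, …, X₁₁`) with their PORT WORDS (boundary circles read in the free group of the
      piece's spine: rank 0 for `D`, 1 for `Y₂, Y₁₁₁, Y₁₂, Y₃`, 2 for `P` and the eleven 8-blocks; the eleven
      port tables are the 11 orbits of the 36 sheet-monodromy pairs `(σ₁, σ₂) ∈ S₃ × S₃` around the two loops of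
      the figure-eight under its order-8 symmetry group — count 11 and boundary-circle range 1–4 as in KMN §4.1;
      tables reproduce KMN Exercise 4.2 (A) and (B));
* §3  `ShadowGraph` = KMN's encoding graph (§4.2) as data: pieces, glued port pairs with a sign, a spanning tree;
      the graph-of-spaces presentation `G.presentation eg er : BalancedPresentation n` in the UNIFORM encoding
      (two letters per piece, one stable letter per glued pair; unused letters and tree stable letters are killed
      by one-letter relators), balanced iff `Σ_v rank(v) = k − 1` iff `χ(X_G) = 1`;
* §4  the three registered stubs and the hypothesis-free, sorry-free composition `DoublesShadowLEOne_of` concluding the crux BY NAME (writer W1 form: the lens’s binder-form `_of` + `_holds` pair folded into one theorem);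
* §5  inhabitedness / sanity examples (the KMN exercises and a contractible member).

STUB 1 `stub_kmnGraphPresentation` (STRUCTURE; theorem in print modulo the typing lemma T-SH1, Martelli's
3-deformation invariance of `S(P)` and the van Kampen conventions of §3): KMN Thm 2.3 («equivalently»: every `M′`
is the double of a 4-dimensional thickening of an `X̄` with `c*(X̄) ≤ 1`), `h = 0` and acyclicity of the retract
for a homotopy sphere, Prop 4.1, §1.2 (`S(P)` = boundaries of the 5-dimensional thickenings, AC-invariant).
STUB 2 `stub_gradeOneAC` (LOAD-BEARING, OPEN, instrumentable per instance): every admissible KMN graph whose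
presentation presents the trivial group gives a stably Andrews–Curtis-trivial presentation (KMN p. 8: «we do not
expect any new manifold, since all the presentations involved should reasonably be Andrews–Curtis equivalent to a
bouquet of spheres (and of course we would have no clue on how to prove the contrary)»).
STUB 3 `stub_acFiveBall` = the tree's NAMED FACT (Andrews–Curtis 1965; Hog-Angeloni–Metzler Ch. I Thm 3.4)
`IsPresentationHandlebodyFive.nonempty_diffeomorph_closedBall_of_isStablyAndrewsCurtisEquivalent`, by name.
The boundary step `∂W = X ∧ W ≅ 𝔻⁵ ⟹ X ≅ S⁴` is PROVED (`BoundaryData.restrictDiffeomorph`, `closedBallBoundaryData 4`).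
-/

open scoped Manifold ContDiff ContinuousMap Topology
open Literature.Topology.FourManifolds

set_option linter.dupNamespace false

noncomputable section

namespace Summit.SmoothPoincare4.SmoothPoincare4.Cruxes.DoublesShadowLEOne.GradeOneAC

/-! ## §1 The typed object (verbatim copy of gen10/ShadowDoubles.lean §1) -/

section Typed

variable (n : ℕ) (M : Type*) [TopologicalSpace M] [ChartedSpace (EuclideanSpace ℝ (Fin 4)) M]

/-- `HasConnectedShadowComplexityLE n M`: the smooth 4-manifold `M` admits a (combinatorially presented, locally
flat) shadow of connected complexity `c* ≤ n` (Martelli arXiv:0909.0168 Def 3.1/Rem 3.10; KMN arXiv:1803.06713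
§2.1–2.2, Def 2.1; Koda–Naoe arXiv:1905.00809 p.4). -/
def HasConnectedShadowComplexityLE : Prop :=
  ∃ (N : ℕ) (K : Geometry.SimplicialComplex ℝ (EuclideanSpace ℝ (Fin N))) (h : K.space ≃ₜ M)
    (P : Set (Finset (EuclideanSpace ℝ (Fin N)))),
    IsSmoothTriangulation 4 K h ∧
    P ⊆ K.faces ∧
    (∀ s ∈ P, ∀ t, t ⊆ s → t.Nonempty → t ∈ P) ∧
    (∀ s ∈ P, s.card ≤ 3) ∧
    (∀ s ∈ K.faces, (∀ v ∈ s, ({v} : Finset (EuclideanSpace ℝ (Fin N))) ∈ P) → s ∈ P) ∧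
    (∃ G : Set (Finset (EuclideanSpace ℝ (Fin N))), (∀ s ∈ G, s.card ≤ 2) ∧
      Relation.ReflTransGen
        (fun F G : Set (Finset (EuclideanSpace ℝ (Fin N))) => ∃ σ τ : Finset (EuclideanSpace ℝ (Fin N)),
          (σ ∈ F ∧ τ ∈ F ∧ σ ⊂ τ ∧ τ.card = σ.card + 1 ∧ ∀ ρ ∈ F, σ ⊂ ρ → ρ = τ) ∧ G = F \ {σ, τ})
        {s | s ∈ K.faces ∧ ∀ v ∈ s, ({v} : Finset (EuclideanSpace ℝ (Fin N))) ∉ P} G) ∧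
    (∀ x : M, x ∈ h '' {y : K.space | ∃ s ∈ P, (y : EuclideanSpace ℝ (Fin N)) ∈ convexHull ℝ (s : Set (EuclideanSpace ℝ (Fin N)))} →
      ∃ U : Set M, IsOpen U ∧ x ∈ U ∧ ∃ f : M → ℝ, ContMDiffOn (𝓡 4) 𝓘(ℝ, ℝ) ∞ f U ∧
        mfderiv (𝓡 4) 𝓘(ℝ, ℝ) f x ≠ 0 ∧
        ∀ y ∈ U, y ∈ h '' {y : K.space | ∃ s ∈ P, (y : EuclideanSpace ℝ (Fin N)) ∈ convexHull ℝ (s : Set (EuclideanSpace ℝ (Fin N)))} →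
          f y = 0) ∧
    (let L : (v : EuclideanSpace ℝ (Fin N)) →
        SimpleGraph {u : EuclideanSpace ℝ (Fin N) // u ≠ v ∧ ({u, v} : Finset (EuclideanSpace ℝ (Fin N))) ∈ P} :=
      (fun v => SimpleGraph.fromRel fun u w => ({u.1, w.1, v} : Finset (EuclideanSpace ℝ (Fin N))) ∈ P);
    let tetra : EuclideanSpace ℝ (Fin N) → Prop := (fun v =>
      (L v).Connected ∧ ∃ B : Finset {u : EuclideanSpace ℝ (Fin N) // u ≠ v ∧ ({u, v} : Finset (EuclideanSpace ℝ (Fin N))) ∈ P},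
        B.card = 4 ∧ (∀ u, u ∈ B ↔ ((L v).neighborSet u).ncard = 3) ∧ (∀ u, u ∉ B → ((L v).neighborSet u).ncard = 2) ∧
        ∀ a ∈ B, ∀ b ∈ B, a ≠ b →
          ∃ S : Set {u : EuclideanSpace ℝ (Fin N) // u ≠ v ∧ ({u, v} : Finset (EuclideanSpace ℝ (Fin N))) ∈ P},
            a ∈ S ∧ b ∈ S ∧ (∀ u ∈ S, u ∈ B → u = a ∨ u = b) ∧ ((L v).induce S).Connected);
    (∀ v, ({v} : Finset (EuclideanSpace ℝ (Fin N))) ∈ P →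
        ((L v).Connected ∧ ∀ u, ((L v).neighborSet u).ncard = 2) ∨
        ((L v).Connected ∧ ∃ a b, a ≠ b ∧ ((L v).neighborSet a).ncard = 3 ∧ ((L v).neighborSet b).ncard = 3 ∧
          (∀ u, u ≠ a → u ≠ b → ((L v).neighborSet u).ncard = 2) ∧
          ((L v).induce {w | w ≠ a}).Connected ∧ ((L v).induce {w | w ≠ b}).Connected) ∨
        tetra v) ∧
      ∀ a, tetra a →
        {b | (SimpleGraph.fromRel fun u w : EuclideanSpace ℝ (Fin N) =>
              {x | x ≠ u ∧ x ≠ w ∧ ({u, w, x} : Finset (EuclideanSpace ℝ (Fin N))) ∈ P}.ncard = 3).Reachable a b ∧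
            tetra b}.ncard ≤ n)

end Typed

/-! ## §2 The KMN pieces at connected complexity ≤ 1 and their port words (arXiv:1803.06713 Prop. 4.1, §4.2) -/

/-- The pieces of KMN Prop. 4.1: the disc `D`, the pair of pants `P`, the Möbius strip `Y₂`, the circle blocks
`Y₁₁₁, Y₁₂, Y₃` (regular neighbourhoods of a circle component of `SX`), and the eleven figure-eight blocks
`X₁, …, X₁₁` (regular neighbourhoods of an 8-shaped component of `SX` through ONE true vertex), indexed here by the
11 orbits of sheet-monodromy pairs (our numbering; KMN's Figure numbering is not reproduced). -/
inductive Piece : Type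
  | disc
  | pants
  | moebius
  | y111
  | y12
  | y3
  | x8 (i : Fin 11)
  deriving DecidableEq

namespace Piece

/-- Rank of the free fundamental group of the piece's spine (point, circle, or figure-eight). -/
def rank : Piece → ℕ
  | disc => 0
  | pants => 2
  | moebius => 1
  | y111 => 1
  | y12 => 1
  | y3 => 1
  | x8 _ => 2

/-- First spine letter `a` (the core circle of `Y₂, Y₁₁₁, Y₁₂, Y₃`; the first loop of the figure-eight). -/
def la : FreeGroup (Fin 2) := FreeGroup.of 0
/-- Second spine letter `b` (second loop of the figure-eight / of the pants' spine). -/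
def lb : FreeGroup (Fin 2) := FreeGroup.of 1

/-- PORT TABLES of the eleven figure-eight blocks: the boundary circles of the regular neighbourhood of the 8-graph
`a ∪ b`, read as words in `F(a, b)` (`A = a⁻¹`, `B = b⁻¹`; total length 6 per block — each of the 6 sheet germs at
the vertex is traversed once).  Orbit representatives `(σ₁, σ₂)` and words (gen11/enum/xpieces.json):
0 `[a, abAB, b]` · 1 `[a, abbAB]` · 2 `[a, abaB, b]` · 3 `[a, abbaB]` · 4 `[a, aBBAB]` · 5 `[a, aB, ab, b]` ·
6 `[a, aB, abb]` · 7 `[abbABa]` · 8 `[abbaBa]` · 9 `[abba, aB]` · 10 `[aba, aBB]`.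
Checks: type 0 + three discs = KMN Exercise 4.2 (A) (torus with discs on meridian and longitude: regions `a`, `b`,
`[a,b]`); type 5 + two discs on `aB`, `ab` + an annulus joining `a`, `b` = Exercise 4.2 (B) (`ℝP²` with an annulus
on two lines), presentation `⟨a, b, t ∣ ab⁻¹, ab, atb^{±1}t⁻¹⟩ ≅ ℤ × ℤ/2 = π₁(ℝP³ × S¹)` as KMN state. -/
def x8Ports : Fin 11 → List (FreeGroup (Fin 2)) :=
  ![ [la, la * lb * la⁻¹ * lb⁻¹, lb],
     [la, la * lb * lb * la⁻¹ * lb⁻¹],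
     [la, la * lb * la * lb⁻¹, lb],
     [la, la * lb * lb * la * lb⁻¹],
     [la, la * lb⁻¹ * lb⁻¹ * la⁻¹ * lb⁻¹],
     [la, la * lb⁻¹, la * lb, lb],
     [la, la * lb⁻¹, la * lb * lb],
     [la * lb * lb * la⁻¹ * lb⁻¹ * la],
     [la * lb * lb * la * lb⁻¹ * la],
     [la * lb * lb * la, la * lb⁻¹],
     [la * lb * la, la * lb⁻¹ * lb⁻¹] ]

/-- PORT WORDS of every piece: `D ↦ [1]` (rank 0); `P ↦ [a, b, ab]` (pants = mapping cylinder of three circles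
onto a figure-eight spine); `Y₂ ↦ [a²]`; `Y₁₁₁ ↦ [a, a, a]`; `Y₁₂ ↦ [a, a²]`; `Y₃ ↦ [a³]`; `Xᵢ ↦ x8Ports i`. -/
def ports : Piece → List (FreeGroup (Fin 2))
  | disc => [1]
  | pants => [la, lb, la * lb]
  | moebius => [la * la]
  | y111 => [la, la, la]
  | y12 => [la, la * la]
  | y3 => [la * la * la]
  | x8 i => x8Ports i

/-- Number of boundary circles (ports) of a piece. -/
def numPorts (p : Piece) : ℕ := p.ports.length

/-- The `j`-th port word of a piece (junk value `1` out of range). -/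
def portWord (p : Piece) (j : ℕ) : FreeGroup (Fin 2) := p.ports.getD j 1

/-- The piece contains a true vertex (it is one of the eleven figure-eight blocks). -/
def hasVertex : Piece → Bool
  | x8 _ => true
  | _ => false

end Piece

/-! ## §3 KMN encoding graphs and their graph-of-spaces presentations -/

/-- A KMN ENCODING GRAPH (arXiv:1803.06713 §4.2) as finite data: `k` pieces, `m` glued pairs of ports (an edge
`e` glues port `src e = (v, j)` to port `tgt e = (v', j')` with orientation `sgn e`; ports not mentioned stay free
boundary circles), and a choice `tree` of edges (meant to be a spanning tree, see `Admissible`). -/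
structure ShadowGraph where
  /-- number of pieces -/
  k : ℕ
  /-- number of glued port pairs -/
  m : ℕ
  /-- the piece at each vertex of the encoding graph -/
  piece : Fin k → Piece
  /-- first port of the `e`-th gluing: (piece index, port index) -/
  src : Fin m → Fin k × ℕ
  /-- second port of the `e`-th gluing -/
  tgt : Fin m → Fin k × ℕ
  /-- gluing orientation of the `e`-th pair of boundary circles -/
  sgn : Fin m → Bool
  /-- the edges of the chosen spanning tree (their stable letters are killed) -/
  tree : Fin m → Bool

namespace ShadowGraph

variable (G : ShadowGraph)

/-- All `2m` port references used by the gluings. -/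
def endpoints : Fin G.m ⊕ Fin G.m → Fin G.k × ℕ := Sum.elim G.src G.tgt

/-- Every referenced port exists. -/
def PortsValid : Prop :=
  ∀ e : Fin G.m, (G.src e).2 < (G.piece (G.src e).1).numPorts ∧ (G.tgt e).2 < (G.piece (G.tgt e).1).numPorts

/-- No boundary circle is glued twice. -/
def PortsInjective : Prop := Function.Injective G.endpoints

/-- The simple graph on pieces spanned by the tree edges. -/
def treeAdj : SimpleGraph (Fin G.k) :=
  SimpleGraph.fromRel fun u v => ∃ e : Fin G.m, G.tree e = true ∧ (G.src e).1 = u ∧ (G.tgt e).1 = v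

/-- The tree edges form a spanning tree of the encoding graph: no tree edge is a self-gluing, they connect all
pieces, and there are exactly `k − 1` of them (so in particular `X_G` is connected). -/
def IsSpanningTree : Prop :=
  (∀ e, G.tree e = true → (G.src e).1 ≠ (G.tgt e).1) ∧ G.treeAdj.Connected ∧
    (Finset.univ.filter fun e => G.tree e = true).card + 1 = G.k

/-- ADMISSIBLE encoding graphs: valid ports, no port glued twice, a genuine spanning tree.  (Connected complexity
≤ 1 is automatic: every figure-eight block is a whole component of `SX_G` with exactly one vertex, since gluing
along boundary circles creates no new singular points.) -/
def Admissible : Prop := G.PortsValid ∧ G.PortsInjective ∧ G.IsSpanningTree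

/-- SUB-GRADING used by the attack on `GradeOneAC`: the number of figure-eight blocks (= true vertices = `c(X_G)`).
`numVertices G = 0` is the vertex-free row decided in print (Naoe: an acyclic simple polyhedron with `c* = 0`
collapses onto a disc, cited in KMN §4.2). -/
def numVertices : ℕ := (Finset.univ.filter fun v => (G.piece v).hasVertex = true).card

/-- GENERATORS of the uniform encoding: two spine letters per piece and one stable letter per glued pair. -/
abbrev Gen : Type := (Fin G.k × Fin 2) ⊕ Fin G.m

/-- RELATOR INDICES of the uniform encoding: one gluing relator per glued pair, one killing relator per tree edge
(its stable letter), one killing relator per unused spine letter `(v, i)` with `rank(piece v) ≤ i`. -/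
abbrev Rel : Type := Fin G.m ⊕ {e : Fin G.m // G.tree e = true} ⊕ {p : Fin G.k × Fin 2 // (G.piece p.1).rank ≤ (p.2 : ℕ)}

/-- The spine letters of piece `v` inside the big free group. -/
def embed (v : Fin G.k) : FreeGroup (Fin 2) →* FreeGroup G.Gen :=
  FreeGroup.map fun i => Sum.inl (v, i)

/-- The word of port `(v, j)` in the big free group. -/
def portWordAt (p : Fin G.k × ℕ) : FreeGroup G.Gen := G.embed p.1 ((G.piece p.1).portWord p.2)

/-- The stable letter of the `e`-th glued pair. -/
def stable (e : Fin G.m) : FreeGroup G.Gen := FreeGroup.of (Sum.inr e)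

/-- The GLUING RELATOR of the `e`-th pair: `w_src · t_e · w_tgt^{±1} · t_e⁻¹` (van Kampen for the graph of spaces
whose vertex spaces are the pieces' mapping cylinders and whose edge spaces are the glued circles). -/
def gluingRelator (e : Fin G.m) : FreeGroup G.Gen :=
  G.portWordAt (G.src e) * G.stable e * (if G.sgn e then G.portWordAt (G.tgt e) else (G.portWordAt (G.tgt e))⁻¹) *
    (G.stable e)⁻¹

/-- All relators of the uniform encoding. -/
def relator : G.Rel → FreeGroup G.Gen
  | Sum.inl e => G.gluingRelator e
  | Sum.inr (Sum.inl e) => G.stable e.1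
  | Sum.inr (Sum.inr p) => FreeGroup.of (Sum.inl p.1)

/-- THE PRESENTATION `P(G)` of the encoding graph, transported to `Fin n` along bijections of the generator and
relator index types (which exist iff `P(G)` is balanced iff `Σ_v rank = k − 1` iff `χ(X_G) = 1`; different
bijections give presentations differing by a renaming of generators and a permutation of relators). -/
def presentation {n : ℕ} (eg : G.Gen ≃ Fin n) (er : G.Rel ≃ Fin n) : BalancedPresentation n :=
  fun j => FreeGroup.map eg (G.relator (er.symm j))

end ShadowGraph

/-- STATEMENT OF STUB 2 (the LOAD-BEARING, OPEN content — grade-one Andrews–Curtis): the presentation of every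
admissible KMN encoding graph that presents the trivial group is stably Andrews–Curtis trivial. -/
def GradeOneAC : Prop :=
  ∀ (G : ShadowGraph) (n : ℕ) (eg : G.Gen ≃ Fin n) (er : G.Rel ≃ Fin n),
    G.Admissible → (G.presentation eg er).PresentsTrivialGroup →
    IsStablyAndrewsCurtisEquivalent (G.presentation eg er) (BalancedPresentation.trivial n)

/-! ## §6 (generation 12; placed before §4 so that STUB 2 can be sharpened) Kernel rungs of the PEELING / DICHOTOMY THEOREM for `GradeOneAC`

Paper theorem (gen12 NODE, `NODE-g12.md`): for every admissible encoding graph `G` with balanced `P(G)`,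
EITHER `H₁(P(G)) ≠ 0` (an explicit character onto `ℤ` or `ℤ/d`, `d ∈ {2,3,4,5}` or a local determinant),
OR `P(G)` is SIGNED-PERMUTED TRIANGULAR (below), hence Andrews–Curtis trivial WITHOUT stabilisation.  In particular
`PresentsTrivialGroup ⟹ H₁ = 0 ⟹ AC-trivial`, i.e. `GradeOneAC`.  The proof is an induction on the number of pieces
("peeling" a leaf of the tree of pieces); its mechanical shadow `gen12/enum/peel.py` was run on ALL 91 821 admissible
balanced tree graphs with `k ≤ 4` pieces and on 60 000 random ones with `k ≤ 24`: zero stuck cases, and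
TRIANGULAR ⟺ `H₁ = 0` in every instance (certificates verified on the words of `P(G)`).

This section lands the parts of that proof that are cheap to put in the kernel today:
* §6.1 `tree_eq_true_of_presentsTrivialGroup` — step L0 of the proof over the ACTUAL model `ShadowGraph.presentation`:
  if `P(G)` presents the trivial group then every glued pair is a tree edge (a non-tree stable letter `t_e` carries a
  character onto `ℤ`), so the encoding graph of a counterexample is a TREE of pieces;
* §6.2 `isAndrewsCurtisEquivalent_trivial_of_perm_sign_isConj_erase` — the CERTIFICATE FORMAT the peeling algorithm
  outputs (a bijection relators → generators, a sign per relator, a rank function) implies AC-triviality: relator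
  permutations (`comp_perm`) and inversions (`update_inv`) followed by the tree's triangular lemma
  `isAndrewsCurtisEquivalent_trivial_of_isConj_erase`;
* §6.3 the finite LOCAL TABLE (★) of the proof: every unimodular pair of port words of a piece is a (signed) triangular
  presentation of rank ≤ 2 — nine word-shapes, each closed by §6.2 in the kernel. -/

section Peel

open BalancedPresentation IsAndrewsCurtisEquivalent

/-! ### §6.0 (self-contained variant only) Vendored: triangular presentations are AC-trivial

VERBATIM COPY of `Literature/Topology/FourManifolds/TriangularPresentationAndrewsCurtis.lean`
lines 150–363 (tree, 2026-08-17: `update_mul_conj`, `update_mul_of_mem_normalClosure`,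
`update_of_isConj`, `inv_mul_erase_mem_normalClosure`, `isAndrewsCurtisEquivalent_update_erase`,
`isAndrewsCurtisEquivalent_trivial_of_isConj_erase`), namespaces flattened into `Vendored`.
It exists ONLY because the Lean farm did not serve that module on 2026-08-30
(`remote:stale:…:unbuilt:Literature.Topology.FourManifolds.TriangularPresentationAndrewsCurtis`,
rc 75 on every request ≈11:50Z–12:08Z); the canonical v2 line file
`GradeOneAC_DoublesShadowLEOne.lean` imports the module instead and has no such section.
DELETE this namespace and switch the one call site (`Vendored.isAndrewsCurtisEquivalent_…`) as
soon as the module is served. No mathematical content of this line lives here. -/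

namespace Vendored

open Function
open Literature.Topology.FourManifolds.IsAndrewsCurtisEquivalent
open Literature.Topology.FourManifolds.BalancedPresentation

variable {n : ℕ}

theorem update_mul_conj (P : BalancedPresentation n) {i j : Fin n} (hij : i ≠ j)
    (w : FreeGroup (Fin n)) :
    IsAndrewsCurtisEquivalent P (update P i (P i * (w * P j * w⁻¹))) := by
  have hji : j ≠ i := hij.symm
  -- two-entry bookkeeping with `a := j`, `b := i`
  have h₀ : P = update (update P j (P j)) i (P i) := (update₂_eq_self P).symm
  conv_lhs => rw [h₀]
  refine (update₂_conj_left P hji (P j) (P i) w).trans ?_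
  refine (update₂_mul_right P hji (w * P j * w⁻¹) (P i)).trans ?_
  refine (update₂_conj_left P hji (w * P j * w⁻¹) (P i * (w * P j * w⁻¹)) w⁻¹).trans ?_
  have e : w⁻¹ * (w * P j * w⁻¹) * w⁻¹⁻¹ = P j := by group
  rw [e, update₂_eq_update' ]
  · exact IsAndrewsCurtisEquivalent.refl _
  · exact hji
where
  /-- `update (update P a (P a)) b y = update P b y`. [folklore] -/
  update₂_eq_update' {P : BalancedPresentation n} {a b : Fin n} {y : FreeGroup (Fin n)}
      (_hab : a ≠ b) : update (update P a (P a)) b y = update P b y := by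
    rw [update_eq_self]

/-- **Multiplying a relator by any consequence of the other relators is an Andrews–Curtis
equivalence**: if `i ∉ S` and `g` lies in the normal closure of the relators `{rⱼ : j ∈ S}`,
then `rᵢ ↦ rᵢ g` is a finite sequence of Andrews–Curtis moves (induction on `g` as a product of
conjugates of the `rⱼ^{±1}`; the inverse of `rᵢ ↦ rᵢ g` is `rᵢ ↦ rᵢ g⁻¹`).
[cite: HogAngeloniMetzler1993, Ch. I §2.3] [cite: AndrewsCurtis1965] -/
theorem update_mul_of_mem_normalClosure (P : BalancedPresentation n) {i : Fin n}
    {S : Set (Fin n)} (hi : i ∉ S) {g : FreeGroup (Fin n)}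
    (hg : g ∈ Subgroup.normalClosure (P '' S)) :
    IsAndrewsCurtisEquivalent P (update P i (P i * g)) := by
  -- strengthen: for every `Q` agreeing with `P` on `S`
  suffices H : ∀ Q : BalancedPresentation n, (∀ j ∈ S, Q j = P j) →
      IsAndrewsCurtisEquivalent Q (update Q i (Q i * g)) from H P fun _ _ => rfl
  change g ∈ Subgroup.closure (Group.conjugatesOfSet (P '' S)) at hg
  induction hg using Subgroup.closure_induction with
  | mem x hx =>
    intro Q hQ
    obtain ⟨a, ⟨j, hjS, rfl⟩, hconj⟩ := Group.mem_conjugatesOfSet_iff.1 hx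
    obtain ⟨c, rfl⟩ := isConj_iff.1 hconj
    have hij : i ≠ j := fun h => hi (h ▸ hjS)
    rw [← hQ j hjS]
    exact update_mul_conj Q hij c
  | one =>
    intro Q _
    simpa using IsAndrewsCurtisEquivalent.refl Q
  | mul x y _ _ ihx ihy =>
    intro Q hQ
    have h₁ := ihx Q hQ
    set Q' : BalancedPresentation n := update Q i (Q i * x) with hQ'
    have hQ'S : ∀ j ∈ S, Q' j = P j := by
      intro j hj
      have hji : j ≠ i := fun h => hi (h ▸ hj)
      rw [hQ', update_of_ne hji, hQ j hj]
    have h₂ := ihy Q' hQ'S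
    have e : update Q' i (Q' i * y) = update Q i (Q i * (x * y)) := by
      rw [hQ', update_self, update_idem, mul_assoc]
    rw [e] at h₂
    exact h₁.trans h₂
  | inv x _ ih =>
    intro Q hQ
    set Q' : BalancedPresentation n := update Q i (Q i * x⁻¹) with hQ'
    have hQ'S : ∀ j ∈ S, Q' j = P j := by
      intro j hj
      have hji : j ≠ i := fun h => hi (h ▸ hj)
      rw [hQ', update_of_ne hji, hQ j hj]
    have h := ih Q' hQ'S
    have e : update Q' i (Q' i * x) = Q := by
      rw [hQ', update_self, update_idem, inv_mul_cancel_right, update_eq_self]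
    rw [e] at h
    exact h.symm

/-- **A relator conjugate to a word may be replaced by that word** (conjugation by the
conjugating element). [cite: AndrewsCurtis1965] -/
theorem update_of_isConj (P : BalancedPresentation n) (i : Fin n) {w : FreeGroup (Fin n)}
    (h : IsConj (P i) w) : IsAndrewsCurtisEquivalent P (update P i w) := by
  obtain ⟨c, hc⟩ := isConj_iff.1 h
  simpa [hc] using update_conj P i c


/-! ### Killing a set of generators -/


/-- **The kernel direction of a substitution `xⱼ ↦ 1` (`p j`), `xⱼ ↦ xⱼ` (`¬ p j`)**: for every
word `w`, `w⁻¹ · erase w` lies in the normal closure of the killed generators `{xⱼ : p j}`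
(induction on `w`; for a product, `(uv)⁻¹ e(uv) = v⁻¹ (u⁻¹ e u) v · v⁻¹ e v`). [folklore] -/
theorem inv_mul_erase_mem_normalClosure (p : Fin n → Prop) [DecidablePred p]
    (w : FreeGroup (Fin n)) :
    w⁻¹ * FreeGroup.lift (fun j => if p j then 1 else FreeGroup.of j) w ∈
      Subgroup.normalClosure (FreeGroup.of '' {j | p j}) := by
  set e : FreeGroup (Fin n) →* FreeGroup (Fin n) :=
    FreeGroup.lift (fun j => if p j then 1 else FreeGroup.of j) with he
  set N := Subgroup.normalClosure (FreeGroup.of '' {j : Fin n | p j}) with hN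
  have hNn : N.Normal := Subgroup.normalClosure_normal
  have e_of_pos : ∀ {x : Fin n}, p x → e (FreeGroup.of x) = 1 := fun {x} hx => by
    simp [he, hx]
  have e_of_neg : ∀ {x : Fin n}, ¬ p x → e (FreeGroup.of x) = FreeGroup.of x := fun {x} hx => by
    simp [he, hx]
  induction w with
  | C1 => simp [N.one_mem]
  | of x =>
    by_cases hx : p x
    · rw [e_of_pos hx, mul_one]
      exact N.inv_mem (Subgroup.subset_normalClosure ⟨x, hx, rfl⟩)
    · rw [e_of_neg hx, inv_mul_cancel]
      exact N.one_mem
  | inv_of x _ =>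
    rw [inv_inv, map_inv]
    by_cases hx : p x
    · rw [e_of_pos hx, inv_one, mul_one]
      exact Subgroup.subset_normalClosure ⟨x, hx, rfl⟩
    · rw [e_of_neg hx, mul_inv_cancel]
      exact N.one_mem
  | mul u v hu hv =>
    have eq : (u * v)⁻¹ * e (u * v) = v⁻¹ * (u⁻¹ * e u) * v⁻¹⁻¹ * (v⁻¹ * e v) := by
      rw [map_mul]; group
    rw [eq]
    exact N.mul_mem (hNn.conj_mem _ hu v⁻¹) hv

/-- If the relators `rⱼ` with `p j` are their own generators, then replacing another relator
`rᵢ` (`¬ p i`) by its image under the substitution `xⱼ ↦ 1` (`p j`) is an Andrews–Curtis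
equivalence (`rᵢ · (rᵢ⁻¹ erase rᵢ)`, the second factor a consequence of the relators
`xⱼ = rⱼ`, `p j`). [cite: KirbyCorks1996, §4, proof of Addendum (C)] [cite: AndrewsCurtis1965] -/
theorem isAndrewsCurtisEquivalent_update_erase (P : BalancedPresentation n)
    (p : Fin n → Prop) [DecidablePred p] {i : Fin n} (hi : ¬ p i)
    (hp : ∀ j, p j → P j = FreeGroup.of j) :
    IsAndrewsCurtisEquivalent P
      (update P i (FreeGroup.lift (fun j => if p j then 1 else FreeGroup.of j) (P i))) := by
  have himg : P '' {j | p j} = FreeGroup.of '' {j | p j} :=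
    Set.image_congr fun j hj => hp j hj
  have hg : (P i)⁻¹ * FreeGroup.lift (fun j => if p j then 1 else FreeGroup.of j) (P i) ∈
      Subgroup.normalClosure (P '' {j | p j}) := by
    rw [himg]
    exact inv_mul_erase_mem_normalClosure p (P i)
  have h := update_mul_of_mem_normalClosure P (S := {j | p j}) hi hg
  rwa [mul_inv_cancel_left] at h

/-! ### Triangular presentations are Andrews–Curtis trivial -/

/-- **Triangular balanced presentations are Andrews–Curtis trivial.**  If, for a rank function
`rk : Fin n → ℕ`, every relator `rᵢ` becomes a conjugate of its generator `xᵢ` under the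
substitution `xⱼ ↦ 1` for `rk j < rk i`, then `P` is Andrews–Curtis equivalent (three moves, no
stabilisation) to the trivial presentation.  Induction on the rank `r`, maintaining a
presentation equivalent to `P` whose relators of rank `< r` are their generators and whose
other relators are untouched: a relator of rank `r` is first replaced by its image under the
substitution (`isAndrewsCurtisEquivalent_update_erase`) and then conjugated to its generator.
This is the algebra of Kirby's *"the `H_l` kill `x₁, …, x_r` and then the `H_{1,i}` kill
`y₁, …, yₙ`"*. [cite: KirbyCorks1996, §4, proof of Addendum (C)] [cite: AndrewsCurtis1965] -/
theorem isAndrewsCurtisEquivalent_trivial_of_isConj_erase (P : BalancedPresentation n)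
    (rk : Fin n → ℕ)
    (h : ∀ i, IsConj (FreeGroup.lift (fun j => if rk j < rk i then 1 else FreeGroup.of j) (P i))
      (FreeGroup.of i)) :
    IsAndrewsCurtisEquivalent P (BalancedPresentation.trivial n) := by
  classical
  -- Claim(r): the relators of rank `< r` can be made trivial, the others untouched
  have claim : ∀ r : ℕ, ∃ Q : BalancedPresentation n, IsAndrewsCurtisEquivalent P Q ∧
      (∀ i, rk i < r → Q i = FreeGroup.of i) ∧ (∀ i, r ≤ rk i → Q i = P i) := by
    intro r
    induction r with
    | zero => exact ⟨P, IsAndrewsCurtisEquivalent.refl P,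
        fun i hi => absurd hi (Nat.not_lt_zero _), fun _ _ => rfl⟩
    | succ r ih =>
      obtain ⟨Q₀, hPQ₀, hlt₀, hge₀⟩ := ih
      -- process the indices of rank exactly `r`, one at a time
      have inner : ∀ T : Finset (Fin n), (∀ i ∈ T, rk i = r) →
          ∃ Q : BalancedPresentation n, IsAndrewsCurtisEquivalent P Q ∧
            (∀ i, rk i < r ∨ i ∈ T → Q i = FreeGroup.of i) ∧
            (∀ i, r ≤ rk i → i ∉ T → Q i = P i) := by
        intro T
        induction T using Finset.induction_on with
        | empty =>
          intro _
          exact ⟨Q₀, hPQ₀, fun i hi => hlt₀ i (hi.resolve_right (Finset.notMem_empty i)),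
            fun i hi _ => hge₀ i hi⟩
        | insert a T haT ihT =>
          intro hT
          obtain ⟨Q, hPQ, hQlt, hQge⟩ := ihT fun i hi => hT i (Finset.mem_insert_of_mem hi)
          have hra : rk a = r := hT a (Finset.mem_insert_self a T)
          have haS : ¬ rk a < rk a := lt_irrefl _
          have hSQ : ∀ j, rk j < rk a → Q j = FreeGroup.of j :=
            fun j hj => hQlt j (Or.inl (hra ▸ hj))
          have hQa : Q a = P a := hQge a (by omega) haT
          -- kill the lower-rank letters of `Q a = P a`, then conjugate to the generator
          have h₁ := isAndrewsCurtisEquivalent_update_erase Q (fun j => rk j < rk a) haS hSQ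
          rw [hQa] at h₁
          set Q₁ : BalancedPresentation n := update Q a
            (FreeGroup.lift (fun j => if rk j < rk a then 1 else FreeGroup.of j) (P a)) with hQ₁
          have hconj : IsConj (Q₁ a) (FreeGroup.of a) := by
            rw [hQ₁, update_self]; exact h a
          have h₂ := update_of_isConj Q₁ a hconj
          have eQ : update Q₁ a (FreeGroup.of a) = update Q a (FreeGroup.of a) := by
            rw [hQ₁, update_idem]
          rw [eQ] at h₂
          refine ⟨update Q a (FreeGroup.of a), hPQ.trans (h₁.trans h₂), ?_, ?_⟩
          · intro i hi
            by_cases hia : i = a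
            · subst hia; simp
            · rw [update_of_ne hia]
              rcases hi with hi | hi
              · exact hQlt i (Or.inl hi)
              · exact hQlt i (Or.inr ((Finset.mem_insert.1 hi).resolve_left hia))
          · intro i hi hiT
            have hia : i ≠ a := fun h' => hiT (h' ▸ Finset.mem_insert_self a T)
            rw [update_of_ne hia]
            exact hQge i hi fun h' => hiT (Finset.mem_insert_of_mem h')
      obtain ⟨Q, hPQ, hQlt, hQge⟩ :=
        inner (Finset.univ.filter fun j => rk j = r) (fun i hi => by simpa using hi)
      refine ⟨Q, hPQ, fun i hi => ?_, fun i hi => ?_⟩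
      · rcases Nat.lt_succ_iff_lt_or_eq.1 hi with hi | hi
        · exact hQlt i (Or.inl hi)
        · exact hQlt i (Or.inr (by simpa using hi))
      · exact hQge i (by omega) (by simp; omega)
  -- at `r = 1 + max rk` every relator is its generator
  obtain ⟨Q, hPQ, hQ, -⟩ := claim (Finset.univ.sup rk + 1)
  have hQt : Q = BalancedPresentation.trivial n := by
    funext i
    exact hQ i (Nat.lt_succ_of_le (Finset.le_sup (f := rk) (Finset.mem_univ i)))
  exact hQt ▸ hPQ


end Vendored


/-! ### §6.1 Step L0: non-tree edges carry a character onto ℤ -/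

namespace ShadowGraph

variable (G : ShadowGraph)

/-- The exponent-sum character of the stable letter `t_e`: `t_e ↦ 1 ∈ ℤ`, every other generator `↦ 0`
(written multiplicatively). -/
def stableCharacter (e : Fin G.m) : FreeGroup G.Gen →* Multiplicative ℤ :=
  FreeGroup.lift fun g => if g = Sum.inr e then Multiplicative.ofAdd 1 else 1

theorem stableCharacter_portWordAt (e : Fin G.m) (p : Fin G.k × ℕ) :
    G.stableCharacter e (G.portWordAt p) = 1 := by
  have h : (G.stableCharacter e).comp (G.embed p.1) = 1 := by
    refine FreeGroup.ext_hom _ _ fun i => ?_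
    simp [stableCharacter, embed]
  change ((G.stableCharacter e).comp (G.embed p.1)) ((G.piece p.1).portWord p.2) = 1
  rw [h]; rfl

theorem stableCharacter_gluingRelator (e e' : Fin G.m) :
    G.stableCharacter e (G.gluingRelator e') = 1 := by
  unfold gluingRelator
  split_ifs <;> simp [map_mul, map_inv, stableCharacter_portWordAt, mul_comm]

/-- The character `t_e ↦ 1` kills every relator of `P(G)` as soon as `e` is NOT a tree edge. -/
theorem stableCharacter_relator (e : Fin G.m) (he : G.tree e = false) (r : G.Rel) :
    G.stableCharacter e (G.relator r) = 1 := by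
  rcases r with e' | ⟨e', he'⟩ | p
  · exact G.stableCharacter_gluingRelator e e'
  · have hne : (Sum.inr e' : G.Gen) ≠ Sum.inr e := by
      intro h
      have : e' = e := Sum.inr_injective h
      rw [this] at he'
      simp [he] at he'
    simp [relator, stable, stableCharacter, hne]
  · simp [relator, stableCharacter]

/-- **Step L0 of the peeling theorem (tree lemma).**  If the uniform presentation `P(G)` of an encoding graph
presents the trivial group, then EVERY glued pair is a tree edge: otherwise the stable letter `t_e` of a non-tree
gluing survives in `H₁` (the character `t_e ↦ 1 ∈ ℤ` kills all relators).  Consequently a counterexample to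
`GradeOneAC` is encoded by a TREE of pieces (`m = k − 1`), the setting of the leaf induction. No admissibility
hypothesis is needed. -/
theorem tree_eq_true_of_presentsTrivialGroup {n : ℕ} (eg : G.Gen ≃ Fin n) (er : G.Rel ≃ Fin n)
    (h : (G.presentation eg er).PresentsTrivialGroup) (e : Fin G.m) : G.tree e = true := by
  by_contra he
  have he' : G.tree e = false := by simpa using he
  -- transport the character to `FreeGroup (Fin n)`
  let ψ : FreeGroup (Fin n) →* Multiplicative ℤ := (G.stableCharacter e).comp (FreeGroup.map eg.symm)
  have hψmap : ∀ x : FreeGroup G.Gen, ψ (FreeGroup.map eg x) = G.stableCharacter e x := by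
    intro x
    have hc : (ψ.comp (FreeGroup.map eg)) = G.stableCharacter e := by
      refine FreeGroup.ext_hom _ _ fun g => ?_
      simp [ψ]
    exact congrArg (fun φ : FreeGroup G.Gen →* Multiplicative ℤ => φ x) hc
  have hrel : ∀ r ∈ Set.range (G.presentation eg er), FreeGroup.lift (fun i => ψ (FreeGroup.of i)) r = 1 := by
    rintro r ⟨j, rfl⟩
    have hl : FreeGroup.lift (fun i => ψ (FreeGroup.of i)) = ψ := by
      refine FreeGroup.ext_hom _ _ fun i => ?_
      simp
    rw [hl]
    show ψ (FreeGroup.map eg (G.relator (er.symm j))) = 1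
    rw [hψmap]
    exact G.stableCharacter_relator e he' _
  -- the induced map on the (trivial) presented group sends `x_{eg (t_e)}` to `1 ∈ ℤ`, absurd
  have hsub : Subsingleton (PresentedGroup (Set.range (G.presentation eg er))) := h
  have h1 : PresentedGroup.toGroup hrel (PresentedGroup.of (eg (Sum.inr e))) = ψ (FreeGroup.of (eg (Sum.inr e))) :=
    PresentedGroup.toGroup.of hrel
  have h2 : (PresentedGroup.of (eg (Sum.inr e)) : PresentedGroup (Set.range (G.presentation eg er))) = 1 :=
    Subsingleton.elim _ _
  rw [h2, map_one] at h1
  have h3 : ψ (FreeGroup.of (eg (Sum.inr e))) = Multiplicative.ofAdd (1 : ℤ) := by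
    simp [ψ, stableCharacter]
  rw [h3] at h1
  exact absurd (Multiplicative.ofAdd.injective (h1.symm.trans rfl)) (by norm_num)

/-- Corollary used by the induction: under `PresentsTrivialGroup` an admissible graph has exactly `k − 1` glued
pairs (all of them tree edges). -/
theorem m_add_one_eq_k_of_presentsTrivialGroup {n : ℕ} (eg : G.Gen ≃ Fin n) (er : G.Rel ≃ Fin n)
    (hA : G.Admissible) (h : (G.presentation eg er).PresentsTrivialGroup) : G.m + 1 = G.k := by
  have hall : (Finset.univ.filter fun e => G.tree e = true) = Finset.univ := by
    apply Finset.filter_true_of_mem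
    intro e _
    exact G.tree_eq_true_of_presentsTrivialGroup eg er h e
  have h3 := hA.2.2.2.2
  rw [hall, Finset.card_univ, Fintype.card_fin] at h3
  exact h3

end ShadowGraph

/-! ### §6.2 The certificate format: signed–permuted triangular presentations are AC-trivial -/

/-- Inverting the relators indexed by `E` is an Andrews–Curtis equivalence (iterated `update_inv`). -/
theorem isAndrewsCurtisEquivalent_invOn {n : ℕ} (P : BalancedPresentation n) (E : Finset (Fin n)) :
    IsAndrewsCurtisEquivalent P (fun i => if i ∈ E then (P i)⁻¹ else P i) := by
  classical
  induction E using Finset.induction_on with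
  | empty => simpa using IsAndrewsCurtisEquivalent.refl P
  | @insert a E ha ih =>
    have key : (fun i => if i ∈ insert a E then (P i)⁻¹ else P i) =
        Function.update (fun i => if i ∈ E then (P i)⁻¹ else P i) a
          ((fun i => if i ∈ E then (P i)⁻¹ else P i) a)⁻¹ := by
      funext i
      by_cases hi : i = a
      · subst hi
        simp [ha]
      · simp [Finset.mem_insert, hi]
    rw [key]
    exact ih.trans (update_inv _ a)

/-- **Signed–permuted triangular presentations are Andrews–Curtis trivial** — the certificate format produced by
the peeling algorithm: a bijection `σ` (generator `i` ↤ relator `σ i`), a sign `s i`, and a rank function `rk`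
such that the relator `(P (σ i))^{∓1}` becomes conjugate to the letter `xᵢ` once the letters of smaller rank are
erased.  Proof: permute the relators (`comp_perm`), invert the flagged ones (`isAndrewsCurtisEquivalent_invOn`),
then apply the tree's triangular lemma `isAndrewsCurtisEquivalent_trivial_of_isConj_erase`. -/
theorem isAndrewsCurtisEquivalent_trivial_of_perm_sign_isConj_erase {n : ℕ} (P : BalancedPresentation n)
    (σ : Equiv.Perm (Fin n)) (s : Fin n → Bool) (rk : Fin n → ℕ)
    (h : ∀ i, IsConj (FreeGroup.lift (fun j => if rk j < rk i then 1 else FreeGroup.of j)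
      (if s i then (P (σ i))⁻¹ else P (σ i))) (FreeGroup.of i)) :
    IsAndrewsCurtisEquivalent P (BalancedPresentation.trivial n) := by
  classical
  have h1 : IsAndrewsCurtisEquivalent P (P ∘ ⇑σ) := comp_perm P σ
  let E : Finset (Fin n) := Finset.univ.filter fun i => s i = true
  have h2 : IsAndrewsCurtisEquivalent (P ∘ ⇑σ) (fun i => if i ∈ E then ((P ∘ ⇑σ) i)⁻¹ else (P ∘ ⇑σ) i) :=
    isAndrewsCurtisEquivalent_invOn _ E
  have hQ : (fun i => if i ∈ E then ((P ∘ ⇑σ) i)⁻¹ else (P ∘ ⇑σ) i) =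
      (fun i => if s i then (P (σ i))⁻¹ else P (σ i)) := by
    funext i
    by_cases hs : s i = true <;> simp [E, hs]
  rw [hQ] at h2
  exact (h1.trans h2).trans (Vendored.isAndrewsCurtisEquivalent_trivial_of_isConj_erase _ rk h)

/-- Stable form (the shape consumed by STUB 3 / `GradeOneAC`). -/
theorem isStablyAndrewsCurtisEquivalent_trivial_of_perm_sign_isConj_erase {n : ℕ} (P : BalancedPresentation n)
    (σ : Equiv.Perm (Fin n)) (s : Fin n → Bool) (rk : Fin n → ℕ)
    (h : ∀ i, IsConj (FreeGroup.lift (fun j => if rk j < rk i then 1 else FreeGroup.of j)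
      (if s i then (P (σ i))⁻¹ else P (σ i))) (FreeGroup.of i)) :
    IsStablyAndrewsCurtisEquivalent P (BalancedPresentation.trivial n) :=
  ⟨0, isAndrewsCurtisEquivalent_trivial_of_perm_sign_isConj_erase P σ s rk h⟩

/-- `GradeOneAC` REDUCED TO THE DICHOTOMY: if every admissible `P(G)` presenting the trivial group admits a
signed–permuted triangular certificate, then `GradeOneAC` holds.  (This is the formal route of the gen12 NODE: the
remaining formalisation is the peeling induction producing `σ, s, rk`; its paper proof is `NODE-g12.md` §3.) -/
def PeelCertificates : Prop :=
  ∀ (G : ShadowGraph) (n : ℕ) (eg : G.Gen ≃ Fin n) (er : G.Rel ≃ Fin n),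
    G.Admissible → (G.presentation eg er).PresentsTrivialGroup →
    ∃ (σ : Equiv.Perm (Fin n)) (s : Fin n → Bool) (rk : Fin n → ℕ),
      ∀ i, IsConj (FreeGroup.lift (fun j => if rk j < rk i then 1 else FreeGroup.of j)
        (if s i then (G.presentation eg er (σ i))⁻¹ else G.presentation eg er (σ i))) (FreeGroup.of i)

theorem gradeOneAC_of_peelCertificates (h : PeelCertificates) : GradeOneAC := by
  intro G n eg er hA htriv
  obtain ⟨σ, s, rk, hc⟩ := h G n eg er hA htriv
  exact isStablyAndrewsCurtisEquivalent_trivial_of_perm_sign_isConj_erase _ σ s rk hc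

/-! ### §6.3 The local table (★): unimodular port-word pairs are signed triangular

The nine word-shapes of the 17 unimodular local configurations `(piece, ports)` of `gen12/enum/localtable.json`
(pants `{a,b},{a,ab},{b,ab}`; `Y₁₁₁`/`Y₁₂` `{a}`; X-type 0,2,5 `{a,b}`; X-type 1 `{a, ab²a⁻¹b⁻¹}`; X-type 3
`{a, ab²ab⁻¹}`; X-type 5 `{a,ab}`, `{a,ab⁻¹}`, `{ab⁻¹,b}`, `{ab,b}`; X-type 6 `{a,ab⁻¹}`), each an Andrews–Curtis
trivial presentation of rank ≤ 2 by ONE substitution.  The 13 non-unimodular configurations carry the abelian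
obstruction `ℤ, ℤ/2, ℤ/3, ℤ/4, ℤ/5` (determinants 0, ±2, ±3, −4, −5) and are the EXCLUDED branches of the proof. -/

namespace LocalTable

open Piece

private theorem fin2_cases (i : Fin 2) : i = 0 ∨ i = 1 := by
  rcases i with ⟨_ | _ | k, hk⟩
  · exact Or.inl rfl
  · exact Or.inr rfl
  · omega

/-- Helper: a rank-2 presentation `![r₀, r₁]` with `r₀^{±1} = a` and `erase_{a} (r₁^{±1}) = b` (rank order
`a < b`; in the table the erased word is literally the letter, no conjugation needed) is AC-trivial. -/
theorem ac_of_two (r₀ r₁ : FreeGroup (Fin 2)) (s₀ s₁ : Bool)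
    (h₀ : (if s₀ then r₀⁻¹ else r₀) = FreeGroup.of 0)
    (h₁ : FreeGroup.lift (fun j : Fin 2 => if j = 0 then (1 : FreeGroup (Fin 2)) else FreeGroup.of j)
      (if s₁ then r₁⁻¹ else r₁) = FreeGroup.of 1) :
    IsAndrewsCurtisEquivalent (![r₀, r₁] : BalancedPresentation 2) (BalancedPresentation.trivial 2) := by
  refine isAndrewsCurtisEquivalent_trivial_of_perm_sign_isConj_erase _ (Equiv.refl _) ![s₀, s₁] ![0, 1] ?_
  intro i
  rcases fin2_cases i with rfl | rfl
  · have e : (FreeGroup.lift fun j : Fin 2 => if (![0, 1] : Fin 2 → ℕ) j < (![0, 1] : Fin 2 → ℕ) 0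
        then (1 : FreeGroup (Fin 2)) else FreeGroup.of j) = MonoidHom.id _ := by
      refine FreeGroup.ext_hom _ _ fun a => ?_
      simp
    rw [e]
    simp only [MonoidHom.id_apply, Equiv.refl_apply, Matrix.cons_val_zero]
    rw [h₀]
  · have e : (FreeGroup.lift fun j : Fin 2 => if (![0, 1] : Fin 2 → ℕ) j < (![0, 1] : Fin 2 → ℕ) 1
        then (1 : FreeGroup (Fin 2)) else FreeGroup.of j) =
        FreeGroup.lift (fun j : Fin 2 => if j = 0 then (1 : FreeGroup (Fin 2)) else FreeGroup.of j) := by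
      refine FreeGroup.ext_hom _ _ fun a => ?_
      rcases fin2_cases a with rfl | rfl <;> simp
    rw [e]
    simp only [Equiv.refl_apply, Matrix.cons_val_one, Matrix.cons_val_zero]
    rw [h₁]

/-- The same with rank order `b < a`: `r₁^{±1} = b`, `erase_{b} (r₀^{±1}) = a`. -/
theorem ac_of_two' (r₀ r₁ : FreeGroup (Fin 2)) (s₀ s₁ : Bool)
    (h₁ : (if s₁ then r₁⁻¹ else r₁) = FreeGroup.of 1)
    (h₀ : FreeGroup.lift (fun j : Fin 2 => if j = 1 then (1 : FreeGroup (Fin 2)) else FreeGroup.of j)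
      (if s₀ then r₀⁻¹ else r₀) = FreeGroup.of 0) :
    IsAndrewsCurtisEquivalent (![r₀, r₁] : BalancedPresentation 2) (BalancedPresentation.trivial 2) := by
  refine isAndrewsCurtisEquivalent_trivial_of_perm_sign_isConj_erase _ (Equiv.refl _) ![s₀, s₁] ![1, 0] ?_
  intro i
  rcases fin2_cases i with rfl | rfl
  · have e : (FreeGroup.lift fun j : Fin 2 => if (![1, 0] : Fin 2 → ℕ) j < (![1, 0] : Fin 2 → ℕ) 0
        then (1 : FreeGroup (Fin 2)) else FreeGroup.of j) =
        FreeGroup.lift (fun j : Fin 2 => if j = 1 then (1 : FreeGroup (Fin 2)) else FreeGroup.of j) := by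
      refine FreeGroup.ext_hom _ _ fun a => ?_
      rcases fin2_cases a with rfl | rfl <;> simp
    rw [e]
    simp only [Equiv.refl_apply, Matrix.cons_val_zero]
    rw [h₀]
  · have e : (FreeGroup.lift fun j : Fin 2 => if (![1, 0] : Fin 2 → ℕ) j < (![1, 0] : Fin 2 → ℕ) 1
        then (1 : FreeGroup (Fin 2)) else FreeGroup.of j) = MonoidHom.id _ := by
      refine FreeGroup.ext_hom _ _ fun a => ?_
      rcases fin2_cases a with rfl | rfl <;> simp
    rw [e]
    simp only [MonoidHom.id_apply, Equiv.refl_apply, Matrix.cons_val_one, Matrix.cons_val_zero]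
    rw [h₁]

/-- (★1) `⟨a, b ∣ a, b⟩` — pants `{a,b}`, X-types 0, 2, 5 with discs on the ports `a`, `b`. -/
theorem pair_a_b : IsAndrewsCurtisEquivalent (![la, lb] : BalancedPresentation 2) (BalancedPresentation.trivial 2) :=
  ac_of_two _ _ false false (by simp [la]) (by simp [lb])

/-- (★2) `⟨a, b ∣ a, ab⟩` — pants `{a,ab}`, X-type 5 `{a,ab}`. -/
theorem pair_a_ab : IsAndrewsCurtisEquivalent (![la, la * lb] : BalancedPresentation 2) (BalancedPresentation.trivial 2) :=
  ac_of_two _ _ false false (by simp [la]) (by simp [la, lb])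

/-- (★3) `⟨a, b ∣ b, ab⟩` — pants `{b,ab}`. -/
theorem pair_b_ab : IsAndrewsCurtisEquivalent (![lb, la * lb] : BalancedPresentation 2) (BalancedPresentation.trivial 2) := by
  have h := comp_swap (![lb, la * lb] : BalancedPresentation 2) 0 1
  have e : ((![lb, la * lb] : BalancedPresentation 2) ∘ ⇑(Equiv.swap (0 : Fin 2) 1)) = ![la * lb, lb] := by
    funext i; rcases fin2_cases i with rfl | rfl <;> rfl
  rw [e] at h
  exact h.trans (ac_of_two' _ _ false false (by simp [lb]) (by simp [la, lb]))

/-- (★4) `⟨a, b ∣ a, ab²a⁻¹b⁻¹⟩` — X-type 1 with both ports capped (`exC`). -/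
theorem pair_x1 : IsAndrewsCurtisEquivalent (![la, la * lb * lb * la⁻¹ * lb⁻¹] : BalancedPresentation 2)
    (BalancedPresentation.trivial 2) :=
  ac_of_two _ _ false false (by simp [la]) (by simp [la, lb])

/-- (★5) `⟨a, b ∣ a, ab²ab⁻¹⟩` — X-type 3 with both ports capped. -/
theorem pair_x3 : IsAndrewsCurtisEquivalent (![la, la * lb * lb * la * lb⁻¹] : BalancedPresentation 2)
    (BalancedPresentation.trivial 2) :=
  ac_of_two _ _ false false (by simp [la]) (by simp [la, lb])

/-- (★6) `⟨a, b ∣ a, ab⁻¹⟩` — X-types 5, 6 `{a, ab⁻¹}` (a relator is INVERTED: sign `s₁ = true`). -/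
theorem pair_a_aB : IsAndrewsCurtisEquivalent (![la, la * lb⁻¹] : BalancedPresentation 2) (BalancedPresentation.trivial 2) :=
  ac_of_two _ _ false true (by simp [la]) (by simp [la, lb])

/-- (★7) `⟨a, b ∣ ab⁻¹, b⟩` — X-type 5 `{ab⁻¹, b}` (rank order `b < a`). -/
theorem pair_aB_b : IsAndrewsCurtisEquivalent (![la * lb⁻¹, lb] : BalancedPresentation 2) (BalancedPresentation.trivial 2) :=
  ac_of_two' _ _ false false (by simp [lb]) (by simp [la, lb])

/-- (★8) `⟨a, b ∣ ab, b⟩` — X-type 5 `{ab, b}` (rank order `b < a`). -/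
theorem pair_ab_b : IsAndrewsCurtisEquivalent (![la * lb, lb] : BalancedPresentation 2) (BalancedPresentation.trivial 2) :=
  ac_of_two' _ _ false false (by simp [lb]) (by simp [la, lb])

/-- (★9) `⟨a ∣ a⟩` — `Y₁₁₁` (any port) and `Y₁₂` (the simple port) capped by a disc. -/
theorem single_a : IsAndrewsCurtisEquivalent (![FreeGroup.of 0] : BalancedPresentation 1) (BalancedPresentation.trivial 1) := by
  have e : (![FreeGroup.of 0] : BalancedPresentation 1) = BalancedPresentation.trivial 1 := by
    funext i; fin_cases i; rfl
  rw [e]; exact IsAndrewsCurtisEquivalent.refl _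

end LocalTable

end Peel

/-! ## §4 The three registered stubs and the composition -/

/-- Local abbreviation: the round 4-sphere. -/
abbrev S4 : Type := (Metric.sphere (0 : EuclideanSpace ℝ (Fin 5)) 1)

/-- STATEMENT OF STUB 1 (structure theorem, KMN): a smooth homotopy 4-sphere of connected shadow complexity ≤ 1
is the boundary of a presentation 5-manifold `H⁵(P(G), ε)` of an ADMISSIBLE KMN encoding graph `G` whose
presentation presents the trivial group. -/
def KMNGraphPresentation : Prop :=
  ∀ (X : Type) [TopologicalSpace X] [T2Space X] [SecondCountableTopology X]
    [ChartedSpace (EuclideanSpace ℝ (Fin 4)) X] [IsManifold (𝓡 4) ∞ X],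
    X ≃ₕ S4 → HasConnectedShadowComplexityLE 1 X →
    ∃ (G : ShadowGraph) (n : ℕ) (eg : G.Gen ≃ Fin n) (er : G.Rel ≃ Fin n),
      G.Admissible ∧ (G.presentation eg er).PresentsTrivialGroup ∧
      ∃ (W : Type) (_ : TopologicalSpace W) (_ : T2Space W) (_ : SecondCountableTopology W)
        (_ : ChartedSpace (EuclideanHalfSpace (4 + 1)) W) (_ : IsManifold (𝓡∂ (4 + 1)) ∞ W) (_ : CompactSpace W),
        IsPresentationHandlebodyFive (G.presentation eg er) W ∧
        ∃ φ : X → W, Manifold.IsSmoothEmbedding (𝓡 4) (𝓡∂ (4 + 1)) ∞ φ ∧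
          Set.range φ = (𝓡∂ (4 + 1)).boundary W


/-- STUB 1 (registered) — KMN structure theorem for homotopy spheres of `c* ≤ 1`, presentation form.
Size L (formalisation of arXiv:1803.06713 Thm 2.3 + Prop 4.1 + §1.2 and Martelli arXiv:0909.0168 behind T-SH1). -/
theorem stub_kmnGraphPresentation : KMNGraphPresentation := by
  sorry

/-- STUB 2 (v2, registered, LOAD-BEARING — sharpened in generation 12): every admissible KMN encoding graph whose
presentation `P(G)` presents the trivial group carries a SIGNED–PERMUTED TRIANGULAR CERTIFICATE (`PeelCertificates`, §6.2).
This is Theorem A(ii) of the gen-12 NODE (`NODE-g12.md` §2–§3: paper proof by peeling leaves of the tree of pieces;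
mechanical census `gen12/enum`: all 91 821 admissible balanced graphs with k ≤ 4 pieces and 60 000 random ones with
k ≤ 24 — 48 693 perfect instances, 48 693 certificates, 0 stuck).  Size M–L (Fin-indexed tree surgery + the finite
local table (★), nine of whose rows are already kernel theorems in §6.3).  Generation 11's STUB 2 `GradeOneAC`
("grade-one Andrews–Curtis", KMN p. 8) is now the THEOREM `gradeOneAC` below, modulo this stub. -/
theorem stub_peelCertificates : PeelCertificates := by
  sorry

/-- Generation 11's STUB 2, from v2 on a theorem modulo `stub_peelCertificates` (kernel-checked reduction
`gradeOneAC_of_peelCertificates`, §6.2: relator permutation + inversions + the tree's triangular lemma). -/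
theorem gradeOneAC : GradeOneAC :=
  gradeOneAC_of_peelCertificates stub_peelCertificates

/-- Nearest tree declaration (critic row 118): `GradeOneAC` is the tree's OPEN (stable) Andrews–Curtis conjecture
`Literature.Topology.FourManifolds.AndrewsCurtisConjecture` (`@[conjecture]`, BalancedPresentation.lean) RESTRICTED to the KMN grade-one
family — the domination `AndrewsCurtisConjecture → GradeOneAC` is one line (PROVED; informational, not used by `DoublesShadowLEOne_of`).
A resisting `P(G)` (an instance where AC search fails) would NOT refute the cell `DoublesShadowLEOne` nor `SmoothPoincare4`:
STUB 2 is STRONGER than what the cell needs (HAM Ch. I (59) has no converse). -/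
theorem gradeOneAC_of_andrewsCurtisConjecture (h : AndrewsCurtisConjecture) : GradeOneAC :=
  fun G n eg er _ htriv => h n (G.presentation eg er) htriv

/-- STUB 3 (registered; the tree's NAMED FACT by name — Andrews–Curtis 1965, Hog-Angeloni–Metzler Ch. I Thm 3.4):
a stably AC-trivial balanced presentation thickens to the 5-ball.  Size L (formalisation of a printed theorem). -/
theorem stub_acFiveBall :
    IsPresentationHandlebodyFive.nonempty_diffeomorph_closedBall_of_isStablyAndrewsCurtisEquivalent := by
  sorry

/-- The boundary step (PROVED): if `X` is embedded as the boundary of `W` and `W ≅ 𝔻⁵` then `X ≅ S⁴` —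
restriction of the diffeomorphism to boundary data (`BoundaryData.restrictDiffeomorph`, Lee Thm 5.11/Cor 5.30)
towards the boundary datum `closedBallBoundaryData 4` of `𝔻⁵`, whose carrier is the round `S⁴`. -/
theorem nonempty_diffeomorph_sphere_of_boundary
    (X : Type) [TopologicalSpace X] [ChartedSpace (EuclideanSpace ℝ (Fin 4)) X] [IsManifold (𝓡 4) ∞ X]
    (W : Type) [TopologicalSpace W] [ChartedSpace (EuclideanHalfSpace (4 + 1)) W]
    (φ : X → W) (hφ : Manifold.IsSmoothEmbedding (𝓡 4) (𝓡∂ (4 + 1)) ∞ φ)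
    (hr : Set.range φ = (𝓡∂ (4 + 1)).boundary W)
    (g : W ≃ₘ⟮𝓡∂ (4 + 1), 𝓡∂ (4 + 1)⟯ (Metric.closedBall (0 : EuclideanSpace ℝ (Fin (4 + 1))) 1)) :
    Nonempty (X ≃ₘ⟮𝓡 4, 𝓡 4⟯ S4) :=
  let bW : BoundaryData (𝓡∂ (4 + 1)) W (𝓡 4) :=
    { carrier := X, incl := φ, isSmoothEmbedding := hφ, range_incl := hr }
  ⟨bW.restrictDiffeomorph (closedBallBoundaryData 4) g⟩

/-- **`DoublesShadowLEOne_of` — THE SKELETON** (writer W1 form: hypothesis-free; the three REGISTERED stubs are used by name):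
STUB 1 → (STUB 2 ⟹ `gradeOneAC`) → STUB 3 → the crux `RootDecompAE.DoublesShadowLEOne` BY NAME (real proof, no sorry of its own; the `IsDouble`
hypothesis of the crux is not used — the line closes the whole `c* ≤ 1` row of homotopy spheres). -/
theorem DoublesShadowLEOne_of :
    Summit.SmoothPoincare4.SmoothPoincare4.Theses.RootDecompAE.DoublesShadowLEOne := by
  intro C _ _ _ _ _ _ _ bC X _ _ _ _ _ e hD hc
  obtain ⟨G, n, eg, er, hadm, htriv, W, _, _, _, _, _, _, hPW, φ, hφ, hr⟩ := stub_kmnGraphPresentation X e hc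
  obtain ⟨g⟩ := stub_acFiveBall n (G.presentation eg er) W hPW (gradeOneAC G n eg er hadm htriv)
  exact nonempty_diffeomorph_sphere_of_boundary X W φ hφ hr g

#print axioms DoublesShadowLEOne_of
#print axioms nonempty_diffeomorph_sphere_of_boundary

/-! ## §5 Inhabitedness and sanity examples -/

namespace Examples

open Piece ShadowGraph

/-- KMN Exercise 4.2 (A): the figure-eight block of type 0 with all three ports capped by discs (a torus with two
discs glued to a meridian and a longitude).  NOT balanced: `Σ rank = 2 ≠ k − 1 = 3` (`χ = 2`, not contractible). -/
def exA : ShadowGraph where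
  k := 4
  m := 3
  piece := ![x8 0, disc, disc, disc]
  src := fun e => (0, (e : ℕ))
  tgt := fun e => (Fin.succ e, 0)
  sgn := fun _ => true
  tree := fun _ => true

/-- KMN Exercise 4.2 (B): the figure-eight block of type 5 (ports `a, aB, ab, b`) with discs on `aB`, `ab` and the
ports `a`, `b` glued to each other (an annulus).  Balanced (9 generators, 9 relators) but the group is
`ℤ × ℤ/2` — a balanced member that does NOT present the trivial group. -/
def exB : ShadowGraph where
  k := 3
  m := 3
  piece := ![x8 5, disc, disc]
  src := ![(0, 1), (0, 2), (0, 0)]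
  tgt := ![(1, 0), (2, 0), (0, 3)]
  sgn := fun _ => true
  tree := ![true, true, false]

/-- A CONTRACTIBLE member: the figure-eight block of type 1 (ports `a`, `ab²a⁻¹b⁻¹`) with both ports capped by
discs — Koda–Naoe's special polyhedron family with one vertex; presentation `⟨a, b ∣ a, ab²a⁻¹b⁻¹⟩` plus killed
letters: presents the trivial group and is Andrews–Curtis trivial by hand (`a = 1 ⟹ b = 1`). -/
def exC : ShadowGraph where
  k := 3
  m := 2
  piece := ![x8 1, disc, disc]
  src := ![(0, 0), (0, 1)]
  tgt := ![(1, 0), (2, 0)]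
  sgn := fun _ => true
  tree := fun _ => true

/-- `exB` is balanced: 9 generators … -/
example : Fintype.card exB.Gen = 9 := by decide
/-- … and 9 relators. -/
example : Fintype.card exB.Rel = 9 := by decide
/-- `exC` is balanced: 8 generators … -/
example : Fintype.card exC.Gen = 8 := by decide
/-- … and 8 relators. -/
example : Fintype.card exC.Rel = 8 := by decide
/-- `exA` is NOT balanced: 11 generators but 12 relators. -/
example : Fintype.card exA.Gen = 11 ∧ Fintype.card exA.Rel = 12 := by decide

/-- The ports referenced by `exC` exist. -/
theorem exC_portsValid : exC.PortsValid := by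
  unfold ShadowGraph.PortsValid; decide

/-- No port of `exC` is glued twice. -/
theorem exC_portsInjective : exC.PortsInjective := by
  unfold ShadowGraph.PortsInjective; decide

/-- The two (tree) edges of `exC` connect its three pieces: a genuine spanning tree. -/
theorem exC_isSpanningTree : exC.IsSpanningTree := by
  have h01 : exC.treeAdj.Adj (0 : Fin 3) (1 : Fin 3) := by
    unfold ShadowGraph.treeAdj
    exact (SimpleGraph.fromRel_adj _ _ _).2 ⟨by decide, Or.inl ⟨(0 : Fin 2), rfl, rfl, rfl⟩⟩
  have h02 : exC.treeAdj.Adj (0 : Fin 3) (2 : Fin 3) := by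
    unfold ShadowGraph.treeAdj
    exact (SimpleGraph.fromRel_adj _ _ _).2 ⟨by decide, Or.inl ⟨(1 : Fin 2), rfl, rfl, rfl⟩⟩
  have hr : ∀ v : Fin 3, exC.treeAdj.Reachable (0 : Fin 3) v := by
    intro v
    fin_cases v
    · exact SimpleGraph.Reachable.refl _
    · exact h01.reachable
    · exact h02.reachable
  refine ⟨by decide, { preconnected := fun u v => (hr u).symm.trans (hr v), nonempty := ⟨(0 : Fin 3)⟩ }, by decide⟩

/-- `exC` is an ADMISSIBLE encoding graph: the hypothesis family of `GradeOneAC` is inhabited by a balanced member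
(and, on paper, one presenting the trivial group: `⟨a, b ∣ a, ab²a⁻¹b⁻¹⟩`). -/
theorem exC_admissible : exC.Admissible := ⟨exC_portsValid, exC_portsInjective, exC_isSpanningTree⟩

end Examples


end Summit.SmoothPoincare4.SmoothPoincare4.Cruxes.DoublesShadowLEOne.GradeOneAC

end
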